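import Summits.NavierStokesRegularity.NavierStokesRegularity.Theses.TerminalTrace
import Literature.Analysis.FluidPDE.ClassicalSuitableRegionEnergy
import Literature.Analysis.FluidPDE.LocalTypeI
import Literature.Analysis.FluidPDE.LerayHopfSpatialGradient
import Literature.Analysis.FluidPDE.AlbrittonBarker2020LocalConcentration

/-!
# `TypeITraceScarL3` in the class «weak-`L³` near `x₀` ALONG A SEQUENCE OF TIMES» — the fence is a
# liminf, and Type I is not used (nsreg-p2 g30, ROUND-32)

Item `TerminalTrace.TypeITraceScarL3` (stmt-NavierStokesRegularity-18385): at a singular point `x₀`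
of a Type-I (in time) Leray–Hopf classical blow-up at time `T`, the terminal profile `u(T)` is not
in `L³` near `x₀`.

ROUND-31 (`typeITraceScarL3_of_localWeakL3Bounded`) fenced off the class
`sup_{T−R²<t<T} ‖u(t)‖_{L^{3,∞}(B(x₀,R))} < ∞` (Seregin 2019, Prop. 1.4).  The printed result of
D. Albritton, T. Barker, *Localised necessary conditions for singularity formation in the
Navier–Stokes equations with curved boundary*, J. Differential Equations 269 (2020) 7529–7573 =
arXiv:1811.00507, **Theorem 3.1** (with Remark 3.4, the interior case) is stronger on the time side:
for a (boundary) suitable weak solution `v` in `Ω × ]0,1[`, bounded on `Ω × ]0,t[` for every `t < 1`,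
if `sup_k ‖v(·,t_k)‖_{L^{3,∞}(Ω_{x*,R})} ≤ M` along SOME sequence `t_k ↑ 1` and the terminal slice
`v(·,1)` is `ε(Ω,M)`-close in `L^{3,∞}` to the class `𝕃` of fields whose weak-`L³` norm on `B(r)`
tends to `0` (distance `0` when `v(·,1) ∈ L³(Ω)`), then `(x*,1)` is a regular point.  No Type-I
hypothesis.  Hence 18385's conclusion holds at `x₀` as soon as
`liminf_{t→T⁻} ‖u(t)‖_{L^{3,∞}(B(x₀,R))} < ∞` for one `R > 0`; the open core of the item is
`‖u(t)‖_{L^{3,∞}(B(x₀,R))} → ∞` as `t → T⁻` for EVERY `R > 0` (the local weak-`L³` norm diverges,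
full limit), together with Type I in time and `u(T) ∈ L³` near `x₀`.

This file records the implication with Theorem 3.1 (interior case, `Ω = B(x₀,R)`, `Γ = ∅`,
terminal slice in `L³(B(x₀,R))`) BY NAME — the Literature fact
`albrittonBarker2020_localWeakL3_regularity` (unit viscosity, Thm. 3.1 + Rmk. 3.4) consumed at viscosity
`ν` through its proved corollary `.of_suitableWeakOn_viscosity` (version 1.2; versions ≤ 1.1 spelled
the same statement out as a hypothesis `hAB`): the class of Definition 2.1 of the source (`v ∈ L_{2,∞} ∩ W^{1,0}_2`, `q ∈ L_{3/2}`,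
distributional Navier–Stokes, local energy inequality) is the tree's `IsSuitableWeakSolutionOn` on
the open backward cylinder + `esssup_t ∫_{B_R}|v|² < ∞` + a weak spatial gradient `G` with
`cknE R z₀ G < ∞` (`∇v ∈ L²(Q_R)`) + `q ∈ L^{3/2}(Q_R)`; boundedness below the top time is
`v ∈ L∞((t₀−R², t') × B_R)` for every `t' < t₀`; the slices `v(·,t)` are tied to the solution by weak
`L²`-continuity on `(t₀−R², t₀]` against `L²` fields supported in the ball (the source's
`C_w([0,T]; L²(Ω))` representative); the sequence is `StrictMono`, in `(t₀−R², t₀)`, tending to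
`t₀`, with `α³·|{x ∈ B_R : |v(x,t_k)| > α}| ≤ M³` for all `k`, `α > 0`; the conclusion «regular
point» is essential boundedness on some backward cylinder `Q(z₀,r)`, `r > 0`.  Printed at `ν = 1`
on `Ω × ]0,1[`; at viscosity `ν` and on `(t₀−R², t₀) × B_R` by the Navier–Stokes scaling (a proved
corollary requested from the typist, as for ROUND-31's `SerLocNu ν`).  Everything else — suitability
of the item's classical solution on the cylinder, the `L∞L²` bound, the square-integrable weak spatial
gradient on the cylinder (v1.1: the Leray–Hopf gradient of `IsLerayHopfOn.exists_hasWeakSpatialGradientOn`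
restricted from the strip `(0,T) × ℝ³`, so `∇u ∈ L²(Q_R)` is PROVED, not assumed), boundedness below
`T`, the weak continuity of the Leray–Hopf slices up to `T` — is PROVED here from the item's hypotheses;
the class hypothesis keeps only `p ∈ L^{3/2}(Q_R)` explicit (true for the physical pressure, not for an
arbitrary classical pressure `p + c(t)` with `c` non-integrable near `T`).
-/

set_option linter.dupNamespace false

open MeasureTheory Set Filter Topology Metric
open scoped ENNReal NNReal RealInnerProductSpace
open Literature.Analysis.FluidPDE

namespace Summit.NavierStokesRegularity.NavierStokesRegularity.Theorems.TypeITraceScarL3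

/-- **`TypeITraceScarL3` restricted to the class «weak-`L³(B(x₀,R))`-bounded along a sequence of
times `t_k ↑ T`», modulo the printed Albritton–Barker localised concentration theorem BY NAME**
(first binder = the Literature fact `albrittonBarker2020_localWeakL3_regularity`, arXiv:1811.00507
Thm. 3.1 + Rmk. 3.4, interior case, terminal slice in `L³`; used at viscosity `ν` via
`.of_suitableWeakOn_viscosity`).  The class hypothesis at `x₀`: for some `M`, some `0 < R` with `R² ≤ T` and some
strictly increasing `t_k → T` in `(T−R², T)`, `h³·|{x ∈ B(x₀,R) : |u(t_k,x)| > h}| ≤ M³` for all `k`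
and `h > 0`, together with `p ∈ L^{3/2}(Q_R)` on `Q_R = (T−R²,T) × B(x₀,R)` (the printed pressure
class; `∇u ∈ L²(Q_R)` is proved from the Leray–Hopf class).  The item's remaining binders are
verbatim; its Type-I hypothesis is idle.
[cite: AlbrittonBarker2020, Thm. 3.1, Rmk. 3.4 (= arXiv:1811.00507 §3)] -/
theorem typeITraceScarL3_of_localWeakL3Slices :
    ∀ (ν T : ℝ), 0 < ν → 0 < T →
    -- the printed theorem (Albritton–Barker 2020, Thm. 3.1 + Rmk. 3.4, interior case) BY NAME
    Literature.Analysis.FluidPDE.albrittonBarker2020_localWeakL3_regularity →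
    ∀ (u : ℝ → EuclideanSpace ℝ (Fin 3) → EuclideanSpace ℝ (Fin 3)) (p : ℝ → EuclideanSpace ℝ (Fin 3) → ℝ),
      IsClassicalNSSolutionOn (Set.Ico 0 T) ν 0 u p →
      IsLerayHopfOn T ν 0 (u 0) u →
      HasRapidSpatialDecay (u 0) →
      IsTypeIBlowup u T →
      ∀ x₀ : EuclideanSpace ℝ (Fin 3),
        -- the class: weak-L³ on `B(x₀,R)`, any size `M`, along SOME sequence of times `t_k ↑ T`,
        -- plus `∇u ∈ L²(Q_R)` and the printed pressure class at that one scale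
        (∃ (M R : ℝ) (s : ℕ → ℝ), 0 < R ∧ R ^ 2 ≤ T ∧ StrictMono s ∧
          (∀ k, s k ∈ Ioo (T - R ^ 2) T) ∧ Tendsto s atTop (𝓝 T) ∧
          (∀ (k : ℕ) (h : ℝ), 0 < h →
            ENNReal.ofReal (h ^ 3) *
                volume.restrict (ball x₀ R) {x : EuclideanSpace ℝ (Fin 3) | h < ‖u (s k) x‖} ≤
              ENNReal.ofReal (M ^ 3)) ∧
          MemLp (Function.uncurry p) (3 / 2) (volume.restrict (parabolicCylinder R (T, x₀)))) →
        (∀ r : ℝ, 0 < r → eLpNorm (Function.uncurry u) ⊤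
          (volume.restrict (parabolicCylinder r (T, x₀))) = ⊤) →
        ∀ ρ : ℝ, 0 < ρ → ¬ MemLp (u T) 3 (volume.restrict (ball x₀ ρ)) := by
  intro ν T hν hT hFA u p hcl hLH _hdec _hTI x₀ hclass hsing ρ hρ hL3
  -- Albritton–Barker 2020, Thm. 3.1 (interior, terminal slice in `L³`) at viscosity `ν`, by name
  have hAB := hFA.of_suitableWeakOn_viscosity hν
  obtain ⟨M, R, s, hR, hRT, hsmono, hsI, hsT, hW, hpL⟩ := hclass
  -- Step 0: shrink the radius to `R' = min R ρ`, so that the terminal slice is `L³` on the whole ball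
  set R' : ℝ := min R ρ with hR'_def
  have hR' : 0 < R' := lt_min hR hρ
  have hR'R : R' ≤ R := min_le_left _ _
  have hR'ρ : R' ≤ ρ := min_le_right _ _
  have hR'T : R' ^ 2 ≤ T := le_trans (pow_le_pow_left₀ hR'.le hR'R 2) hRT
  have hQsub : parabolicCylinder R' (T, x₀) ⊆ parabolicCylinder R (T, x₀) := by
    have h2 : R' ^ 2 ≤ R ^ 2 := pow_le_pow_left₀ hR'.le hR'R 2
    exact prod_mono (Ioo_subset_Ioo (by linarith) le_rfl) (ball_subset_ball hR'R)
  -- Step 1: the item's classical solution is a suitable weak solution on the backward cylinder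
  have hsub : parabolicCylinder R' (T, x₀) ⊆ Set.Ico 0 T ×ˢ (univ : Set (EuclideanSpace ℝ (Fin 3))) := by
    intro z hz
    rw [mem_parabolicCylinder] at hz
    refine mem_prod.2 ⟨⟨?_, ?_⟩, mem_univ _⟩
    · have h1 : T - R' ^ 2 < z.1 := hz.1.1
      linarith
    · exact hz.1.2
  have hreg : IsClassicalNSSolutionOnRegion (parabolicCylinder R' (T, x₀)) ν 0 u p :=
    hcl.onRegion.mono_of_isOpen hsub (isOpen_parabolicCylinder R' (T, x₀))
  have hsw : IsSuitableWeakSolutionOn (parabolicCylinderOpens R' (T, x₀)) ν 0 u p :=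
    hreg.isSuitableWeakSolutionOn (isOpen_parabolicCylinder R' (T, x₀)) hν
  -- Step 1a: the Leray–Hopf weak spatial gradient `G` on the strip `(0,T) × ℝ³`, square
  -- integrable (`u ∈ L²(0,T; Ḣ¹)`), restricted to the cylinder: `cknE R' (T,x₀) G < ∞` is PROVED.
  obtain ⟨G, hGslab, -, hGint, -⟩ := hLH.exists_hasWeakSpatialGradientOn
  have hQslab : parabolicCylinder R' (T, x₀) ⊆ Ioo 0 T ×ˢ (univ : Set (EuclideanSpace ℝ (Fin 3))) := by
    intro z hz
    rw [mem_parabolicCylinder] at hz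
    refine mem_prod.2 ⟨⟨?_, hz.1.2⟩, mem_univ _⟩
    have h1 : T - R' ^ 2 < z.1 := hz.1.1
    linarith
  have hG : HasWeakSpatialGradientOn (parabolicCylinderOpens R' (T, x₀)) u G :=
    hGslab.mono (fun z hz => mem_slab.2 (mem_prod.1 (hQslab hz)).1)
  have hfin' : cknE R' (T, x₀) G < ⊤ := by
    rw [cknE]
    refine ENNReal.mul_lt_top (ENNReal.inv_lt_top.2 (ENNReal.ofReal_pos.2 hR')) ?_
    exact lt_of_le_of_lt (lintegral_mono_set hQslab) hGint
  -- Step 1b: `u ∈ L∞(T−R'², T; L²(B(x₀,R')))` from the Leray–Hopf energy bound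
  have hL2 : ∃ C : ℝ≥0, ∀ᵐ t ∂(volume.restrict (Ioo (T - R' ^ 2) T)),
      ∫⁻ x in ball x₀ R', ‖u t x‖ₑ ^ 2 ≤ C := by
    obtain ⟨C, hC⟩ := hLH.energy_bound
    refine ⟨C, ?_⟩
    have hsubI : Ioo (T - R' ^ 2) T ⊆ Ioo 0 T :=
      Ioo_subset_Ioo (by nlinarith [sq_nonneg R']) le_rfl
    filter_upwards [ae_restrict_of_ae_restrict_of_subset hsubI hC] with t ht
    exact (setLIntegral_le_lintegral _ _).trans (by simpa [eEnergy] using ht)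
  -- Step 1c: the pressure class on the smaller cylinder
  have hpL' : MemLp (Function.uncurry p) (3 / 2) (volume.restrict (parabolicCylinder R' (T, x₀))) :=
    hpL.mono_measure (Measure.restrict_mono hQsub le_rfl)
  -- Step 1d: the classical solution is bounded on `(T−R'², t') × B(x₀,R')` for every `t' < T`
  have hbdd : ∀ t' ∈ Ioo (T - R' ^ 2) T, eLpNorm (Function.uncurry u) ⊤
      (volume.restrict (Ioo (T - R' ^ 2) t' ×ˢ ball x₀ R')) < ⊤ := by
    intro t' ht'
    have hK : IsCompact (Icc (T - R' ^ 2) t' ×ˢ closedBall x₀ R') :=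
      (isCompact_Icc).prod (isCompact_closedBall x₀ R')
    have hKsub : Icc (T - R' ^ 2) t' ×ˢ closedBall x₀ R' ⊆
        Set.Ico 0 T ×ˢ (univ : Set (EuclideanSpace ℝ (Fin 3))) := by
      refine prod_mono (fun t ht => ⟨?_, ?_⟩) (subset_univ _)
      · have := ht.1; nlinarith [sq_nonneg R']
      · exact lt_of_le_of_lt ht.2 ht'.2
    have hcont : ContinuousOn (Function.uncurry u) (Icc (T - R' ^ 2) t' ×ˢ closedBall x₀ R') :=
      hcl.smooth_velocity.continuousOn.mono hKsub
    obtain ⟨B, hB⟩ := hK.exists_bound_of_continuousOn hcont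
    have hae : ∀ᵐ z ∂(volume.restrict (Ioo (T - R' ^ 2) t' ×ˢ ball x₀ R')),
        ‖Function.uncurry u z‖ ≤ B := by
      refine ae_restrict_of_forall_mem (measurableSet_Ioo.prod measurableSet_ball) ?_
      intro z hz
      exact hB z (prod_mono Ioo_subset_Icc_self ball_subset_closedBall hz)
    rw [eLpNorm_exponent_top]
    exact eLpNormEssSup_lt_top_of_ae_bound hae
  -- Step 2: the Leray–Hopf slices are weakly `L²`-continuous on `(T−R'², T]`
  have hwc : ∀ w : EuclideanSpace ℝ (Fin 3) → EuclideanSpace ℝ (Fin 3), MemLp w 2 volume →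
      Function.support w ⊆ ball x₀ R' →
      ContinuousOn (fun t => ∫ x, ⟪u t x, w x⟫) (Ioc (T - R' ^ 2) T) := by
    intro w hw _
    refine (hLH.weak_continuous w hw).1.mono (Ioc_subset_Ioc ?_ le_rfl)
    nlinarith [sq_nonneg R']
  -- Step 3: the sequence of quiet slices, shifted into `(T−R'², T)`
  have hev : ∀ᶠ k in atTop, T - R' ^ 2 < s k :=
    (hsT.eventually (lt_mem_nhds (by nlinarith [sq_nonneg R'] : T - R' ^ 2 < T)))
  obtain ⟨K, hK⟩ := hev.exists_forall_of_atTop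
  have hseq : ∃ s' : ℕ → ℝ, StrictMono s' ∧ (∀ k, s' k ∈ Ioo (T - R' ^ 2) T) ∧
      Tendsto s' atTop (𝓝 T) ∧
      ∀ (k : ℕ) (α : ℝ), 0 < α →
        ENNReal.ofReal (α ^ 3) *
            volume.restrict (ball x₀ R') {x : EuclideanSpace ℝ (Fin 3) | α < ‖u (s' k) x‖} ≤
          ENNReal.ofReal (M ^ 3) := by
    refine ⟨fun k => s (k + K), fun a b hab => hsmono (by omega), fun k => ⟨hK _ (by omega), (hsI _).2⟩,
      hsT.comp (tendsto_add_atTop_nat K), fun k α hα => ?_⟩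
    refine le_trans ?_ (hW (k + K) α hα)
    gcongr
  -- Step 4: the terminal slice is `L³` on the whole ball `B(x₀,R')`
  have hL3' : MemLp (u T) 3 (volume.restrict (ball x₀ R')) :=
    hL3.mono_measure (Measure.restrict_mono (ball_subset_ball hR'ρ) le_rfl)
  -- Step 5: the printed theorem gives a bounded backward cylinder at `(T,x₀)`: contradiction
  obtain ⟨r, hr, hbd⟩ := hAB (T, x₀) R' M hR' u p hsw hL2 hpL' G hG hfin' hbdd hwc hseq hL3'
  exact hbd.ne (hsing r hr)

end Summit.NavierStokesRegularity.NavierStokesRegularity.Theorems.TypeITraceScarL3
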